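import Mathlib
import HarnessLib
import Summits.Ventures.LatticeQCDFlow.Scoring.ReweightingMedianOfBlocks

/-!
# Block means and their median under a `(1 + ε)`-th MOMENT ONLY (heavy tails beyond `L²`): for a
# non-negative score `g` with `A = ∫ g^{1+ε} dν < ∞`, `0 < ε ≤ 1`,
# `P(η ≤ |Ḡ_m − ∫ g dν|) ≤ 5A/(m^ε η^{1+ε})` by truncation at `T = mη`, and the median over `R`
# blocks is within `η` of `∫ g dν` with probability `≥ 1 − e^{−R/8}` once `20A ≤ m^ε η^{1+ε}`

HONEST FRAMING: exact (Metropolis-corrected) sampling algorithms for lattice gauge theory;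
figures of merit are autocorrelation/cost numbers at stated couplings and volumes; no
continuum-physics claim.

Venture `LatticeQCDFlow` (cell pub-lqcd), topic `Scoring`; FANOUT row 4 (`s0-u1-b`, rung S0-B).
Row 4's median-of-blocks certificates (`Scoring/ReweightingMedianOfBlocks`,
`Scoring/KishESSBlockStatistics`, …) feed Chebyshev per block and therefore ask for a SECOND
moment of the block score (`w² ∈ L²`, i.e. a fourth weight moment, for the ESS column) and list
'heavy tails beyond `L²`' as NOT CLAIMED.  Importance weights are the textbook heavy-tailed case,
so this file replaces Chebyshev by the elementary TRUNCATION bound that needs only a `(1 + ε)`-th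
moment of a NON-NEGATIVE score: with `T = mη`, either some draw exceeds `T` (union bound + Markov
on `g^{1+ε}`: `≤ mA/T^{1+ε} = A/(m^ε η^{1+ε})`), or all draws are `≤ T`, the block mean equals the
mean of the truncated scores `min(g, T)` — whose variance is `≤ T^{1−ε}A` and whose mean is within
`A/T^ε ≤ η/2` of `∫ g dν` — and Chebyshev for the truncated mean costs `4A/(m^ε η^{1+ε})`.  The
median device of row 4 (`BlockMedian.measureReal_half_far_le`) then gives the exponential
certificate.  The median-of-means estimator under `(1 + ε)`-th moments is classical
(Nemirovsky–Yudin 1983; Bubeck–Cesa-Bianchi–Lugosi, IEEE Trans. Inform. Theory 59 (2013) Lemma 2,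
via the von Bahr–Esseen inequality; Devroye–Lerasle–Lugosi–Oliveira 2016; Lugosi–Mendelson 2019
§2) — printed counterparts NAMED ONLY; the truncation route and its constant `5` are ours and
elementary.  NEW WORK of the cell; no definition; nothing cited as a fact.

## Content (`(Ω, P)` probability space; draws `x_j` independent with common law `ν` on `X`;
## `g ≥ 0` measurable, `A = ∫ g^{1+ε} dν` as `Integrable (fun a => g a ^ (1 + ε)) ν`, `0 < ε ≤ 1`)

* §1 pointwise pieces: `self_le_one_add_rpow` (`z ≤ 1 + z^{1+ε}`), `min_sq_le_rpow`
  (`min(z, T)² ≤ T^{1−ε} z^{1+ε}`), `sub_min_le_rpow_div` (`z − min(z, T) ≤ z^{1+ε}/T^ε`).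
* §2 under `ν`: `integrable_of_rpow_moment` (`g ∈ L¹`), **`measureReal_lt_le_rpow_moment`**
  (Markov: `ν{T < g} ≤ A/T^{1+ε}`), `memLp_min_const`, **`variance_min_le`**
  (`Var_ν min(g, T) ≤ T^{1−ε}A`), **`integral_sub_integral_min_le`** (`∫ g − ∫ min(g, T) ≤ A/T^ε`).
* §3 **`blockMean_heavyTail_iid`** — `m ≥ 1` i.i.d. draws, `η > 0`:
  `P(η ≤ |Σ_j g(x_j)/m − ∫ g dν|) ≤ 5A/(m^ε η^{1+ε})`.
* §4 **`blockMean_medianOfBlocks_confidence_heavyTail`** — one stream `y` of `n` draws, blocks of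
  `m ≥ 1`, `R·m ≤ n`, `20A ≤ m^ε η^{1+ε}`: `P(#{r < R : η ≤ |Ḡ_r − ∫ g dν|} ≥ R/2) ≤ exp(−R/8)`;
  `blockMean_sampleMedian_confidence_heavyTail` (ANY sample-median selection).

Reading (value-free): with only `E g^{1+ε} < ∞` the price of confidence `1 − η'` is still
`R ≈ 8 log(1/η')` blocks, and the block radius scales like `(20A)^{1/(1+ε)} m^{−ε/(1+ε)}` instead of
`2√(Var/m)`.  NOT CLAIMED: signed scores (split into positive and negative parts); the optimal
constant; `ε > 1` (use the `L²` files); estimating `A`; any number of ours re-scored.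
-/

noncomputable section

namespace Summit.Ventures.LatticeQCDFlow.Scoring.HeavyTailMedian

open MeasureTheory ProbabilityTheory Finset Real Set
open Summit.Ventures.LatticeQCDFlow.Scoring.BlockMedian
open Summit.Ventures.LatticeQCDFlow.Scoring.AllPairsMedian
open Summit.Ventures.LatticeQCDFlow.Scoring.ReweightingMedian

/-! ## §1 Pointwise pieces -/

section Pointwise

variable {z T ε : ℝ}

/-- `z ≤ 1 + z^{1+ε}` for `z ≥ 0`, `ε ≥ 0` (so a `(1 + ε)`-th moment gives a first moment on a
probability space). [ours] -/
theorem self_le_one_add_rpow (hz : 0 ≤ z) (hε : 0 ≤ ε) : z ≤ 1 + z ^ (1 + ε) := by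
  have h0 : 0 ≤ z ^ (1 + ε) := Real.rpow_nonneg hz _
  rcases le_or_gt z 1 with hz1 | hz1
  · linarith
  · have h : z ^ (1 : ℝ) ≤ z ^ (1 + ε) := Real.rpow_le_rpow_of_exponent_le hz1.le (by linarith)
    rw [Real.rpow_one] at h
    linarith

/-- `min(z, T)² ≤ T^{1−ε}·z^{1+ε}` for `z, T ≥ 0`, `0 ≤ ε ≤ 1` (the truncated score has a second
moment controlled by the `(1 + ε)`-th moment of the score). [ours] -/
theorem min_sq_le_rpow (hz : 0 ≤ z) (hT : 0 ≤ T) (hε0 : 0 ≤ ε) (hε1 : ε ≤ 1) :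
    min z T ^ 2 ≤ T ^ (1 - ε) * z ^ (1 + ε) := by
  have e2 : (1 - ε) + (1 + ε) = (2 : ℝ) := by ring
  rcases le_total z T with hzT | hTz
  · rw [min_eq_left hzT]
    calc z ^ 2 = z ^ ((1 - ε) + (1 + ε)) := by rw [e2, Real.rpow_two]
      _ = z ^ (1 - ε) * z ^ (1 + ε) := Real.rpow_add' hz (by rw [e2]; norm_num)
      _ ≤ T ^ (1 - ε) * z ^ (1 + ε) :=
          mul_le_mul_of_nonneg_right (Real.rpow_le_rpow hz hzT (by linarith))
            (Real.rpow_nonneg hz _)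
  · rw [min_eq_right hTz]
    calc T ^ 2 = T ^ ((1 - ε) + (1 + ε)) := by rw [e2, Real.rpow_two]
      _ = T ^ (1 - ε) * T ^ (1 + ε) := Real.rpow_add' hT (by rw [e2]; norm_num)
      _ ≤ T ^ (1 - ε) * z ^ (1 + ε) :=
          mul_le_mul_of_nonneg_left (Real.rpow_le_rpow hT hTz (by linarith))
            (Real.rpow_nonneg hT _)

/-- `z − min(z, T) ≤ z^{1+ε}/T^ε` for `z ≥ 0`, `T > 0`, `ε ≥ 0` (the truncation bias is paid by the
`(1 + ε)`-th moment). [ours] -/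
theorem sub_min_le_rpow_div (hz : 0 ≤ z) (hT : 0 < T) (hε : 0 ≤ ε) :
    z - min z T ≤ z ^ (1 + ε) / T ^ ε := by
  have hTε : 0 < T ^ ε := Real.rpow_pos_of_pos hT _
  have h0 : 0 ≤ z ^ (1 + ε) / T ^ ε := div_nonneg (Real.rpow_nonneg hz _) hTε.le
  rcases le_total z T with hzT | hTz
  · rw [min_eq_left hzT, sub_self]
    exact h0
  · rw [min_eq_right hTz, le_div_iff₀ hTε]
    have hzpos : 0 < z := hT.trans_le hTz
    have h1 : T ^ ε ≤ z ^ ε := Real.rpow_le_rpow hT.le hTz hε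
    have h2 : z ^ (1 + ε) = z * z ^ ε := by
      rw [Real.rpow_add hzpos, Real.rpow_one]
    rw [h2]
    nlinarith [mul_le_mul_of_nonneg_left h1 hz, hT.le, hTε.le]

end Pointwise

/-! ## §2 The score under its law: Markov, the truncated variance, the truncation bias -/

section Law

variable {X : Type*} [MeasurableSpace X] {ν : Measure X} [IsProbabilityMeasure ν] {g : X → ℝ}
  {ε : ℝ}

/-- A `(1 + ε)`-th moment on a probability space gives integrability (`g ≤ 1 + g^{1+ε}`). [ours] -/
theorem integrable_of_rpow_moment (hgm : Measurable g) (hg0 : ∀ a, 0 ≤ g a) (hε : 0 ≤ ε)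
    (hA : Integrable (fun a => g a ^ (1 + ε)) ν) : Integrable g ν := by
  refine Integrable.mono' ((integrable_const (1 : ℝ)).add hA) hgm.aestronglyMeasurable
    (Filter.Eventually.of_forall fun a => ?_)
  rw [Real.norm_eq_abs, abs_of_nonneg (hg0 a)]
  exact self_le_one_add_rpow (hg0 a) hε

/-- **MARKOV at the `(1 + ε)`-th moment**: `ν{T < g} ≤ (∫ g^{1+ε} dν)/T^{1+ε}` for `T > 0`.
[ours] -/
theorem measureReal_lt_le_rpow_moment (hg0 : ∀ a, 0 ≤ g a) (hε : 0 ≤ ε)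
    (hA : Integrable (fun a => g a ^ (1 + ε)) ν) {T : ℝ} (hT : 0 < T) :
    ν.real {a | T < g a} ≤ (∫ a, g a ^ (1 + ε) ∂ν) / T ^ (1 + ε) := by
  have hT' : 0 < T ^ (1 + ε) := Real.rpow_pos_of_pos hT _
  rw [le_div_iff₀ hT', mul_comm]
  calc T ^ (1 + ε) * ν.real {a | T < g a}
      ≤ T ^ (1 + ε) * ν.real {a | T ^ (1 + ε) ≤ g a ^ (1 + ε)} := by
        refine mul_le_mul_of_nonneg_left (measureReal_mono fun a (ha : T < g a) => ?_) hT'.le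
        exact Real.rpow_le_rpow hT.le ha.le (by linarith)
    _ ≤ ∫ a, g a ^ (1 + ε) ∂ν := mul_meas_ge_le_integral_of_nonneg
        (Filter.Eventually.of_forall fun a => Real.rpow_nonneg (hg0 a) _) hA _

/-- The truncated score `min(g, T)` (`T ≥ 0`) is bounded, hence square-integrable. [ours] -/
theorem memLp_min_const (hgm : Measurable g) (hg0 : ∀ a, 0 ≤ g a) {T : ℝ} (hT : 0 ≤ T) :
    MemLp (fun a => min (g a) T) 2 ν :=
  MemLp.of_bound (hgm.min measurable_const).aestronglyMeasurable T
    (Filter.Eventually.of_forall fun a => by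
      rw [Real.norm_eq_abs, abs_of_nonneg (le_min (hg0 a) hT)]
      exact min_le_right _ _)

/-- **The truncated variance**: `Var_ν min(g, T) ≤ T^{1−ε}·∫ g^{1+ε} dν` (`T > 0`, `0 ≤ ε ≤ 1`).
[ours] -/
theorem variance_min_le (hgm : Measurable g) (hg0 : ∀ a, 0 ≤ g a) (hε0 : 0 ≤ ε) (hε1 : ε ≤ 1)
    (hA : Integrable (fun a => g a ^ (1 + ε)) ν) {T : ℝ} (hT : 0 < T) :
    Var[fun a => min (g a) T; ν] ≤ T ^ (1 - ε) * ∫ a, g a ^ (1 + ε) ∂ν := by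
  rw [variance_eq_sub (memLp_min_const hgm hg0 hT.le)]
  simp only [Pi.pow_apply]
  have h1 : ∫ a, min (g a) T ^ 2 ∂ν ≤ ∫ a, T ^ (1 - ε) * g a ^ (1 + ε) ∂ν :=
    integral_mono_of_nonneg (Filter.Eventually.of_forall fun a => sq_nonneg _) (hA.const_mul _)
      (Filter.Eventually.of_forall fun a => min_sq_le_rpow (hg0 a) hT.le hε0 hε1)
  rw [integral_const_mul] at h1
  nlinarith [sq_nonneg (∫ a, min (g a) T ∂ν)]

/-- **The truncation bias**: `0 ≤ ∫ g dν − ∫ min(g, T) dν ≤ (∫ g^{1+ε} dν)/T^ε` (`T > 0`). [ours] -/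
theorem integral_sub_integral_min_le (hgm : Measurable g) (hg0 : ∀ a, 0 ≤ g a) (hε : 0 ≤ ε)
    (hA : Integrable (fun a => g a ^ (1 + ε)) ν) {T : ℝ} (hT : 0 < T) :
    ∫ a, min (g a) T ∂ν ≤ ∫ a, g a ∂ν
      ∧ ∫ a, g a ∂ν - ∫ a, min (g a) T ∂ν ≤ (∫ a, g a ^ (1 + ε) ∂ν) / T ^ ε := by
  have hgi := integrable_of_rpow_moment hgm hg0 hε hA
  have hmin : Integrable (fun a => min (g a) T) ν := (memLp_min_const hgm hg0 hT.le).integrable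
    one_le_two
  refine ⟨integral_mono hmin hgi fun a => min_le_left _ _, ?_⟩
  rw [← integral_sub hgi hmin, ← integral_div]
  exact integral_mono (hgi.sub hmin) (hA.div_const _) fun a => sub_min_le_rpow_div (hg0 a) hT hε

end Law

/-! ## §3 The block mean under a `(1 + ε)`-th moment -/

section BlockMean

variable {Ω : Type*} [MeasurableSpace Ω] {P : Measure Ω} [IsProbabilityMeasure P]
variable {X : Type*} [MeasurableSpace X] {ν : Measure X} {g : X → ℝ} {ε : ℝ} {n m R : ℕ}

/-- **THE BLOCK MEAN OF `m` I.I.D. DRAWS UNDER A `(1 + ε)`-TH MOMENT.**  `g ≥ 0` measurable with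
`A = ∫ g^{1+ε} dν < ∞`, `0 < ε ≤ 1`, `m ≥ 1`, `η > 0`:
`P(η ≤ |Σ_j g(x_j)/m − ∫ g dν|) ≤ 5A/(m^ε η^{1+ε})` (truncation at `T = mη`). [ours] -/
theorem blockMean_heavyTail_iid {x : Fin m → Ω → X} (hxm : ∀ j, Measurable (x j))
    (hind : iIndepFun x P) (hlaw : ∀ j, Measure.map (x j) P = ν) (hgm : Measurable g)
    (hg0 : ∀ a, 0 ≤ g a) (hε0 : 0 < ε) (hε1 : ε ≤ 1)
    (hA : Integrable (fun a => g a ^ (1 + ε)) ν) (hm : 1 ≤ m) {η : ℝ} (hη : 0 < η) :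
    P.real {ω | η ≤ |(∑ j : Fin m, g (x j ω)) / m - ∫ a, g a ∂ν|}
      ≤ 5 * (∫ a, g a ^ (1 + ε) ∂ν) / ((m : ℝ) ^ ε * η ^ (1 + ε)) := by
  haveI hν : IsProbabilityMeasure ν :=
    isProbabilityMeasure_of_map_eq_iid (hxm ⟨0, hm⟩) (hlaw ⟨0, hm⟩)
  set A : ℝ := ∫ a, g a ^ (1 + ε) ∂ν with hAdef
  have hA0 : 0 ≤ A := integral_nonneg fun a => Real.rpow_nonneg (hg0 a) _
  have hm0 : (0 : ℝ) < m := by exact_mod_cast hm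
  have hD : 0 < (m : ℝ) ^ ε * η ^ (1 + ε) :=
    mul_pos (Real.rpow_pos_of_pos hm0 _) (Real.rpow_pos_of_pos hη _)
  by_cases hsmall : 2 * A ≤ (m : ℝ) ^ ε * η ^ (1 + ε)
  swap
  · -- trivial regime: the bound exceeds `5/2`
    push Not at hsmall
    refine measureReal_le_one.trans ?_
    rw [le_div_iff₀ hD]
    linarith
  -- truncation level `T = mη` and the three power identities it satisfies
  set T : ℝ := m * η with hT
  have hT0 : 0 < T := mul_pos hm0 hη
  have eT1 : T ^ (1 + ε) = (m : ℝ) * ((m : ℝ) ^ ε * η ^ (1 + ε)) := by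
    rw [hT, Real.mul_rpow hm0.le hη.le, Real.rpow_add hm0, Real.rpow_one]
    ring
  have eT2 : T ^ (1 - ε) * ((m : ℝ) ^ ε * η ^ (1 + ε)) = (m : ℝ) * η ^ 2 := by
    have h1 : (m : ℝ) ^ (1 - ε) * (m : ℝ) ^ ε = m := by
      rw [← Real.rpow_add hm0, show (1 : ℝ) - ε + ε = 1 by ring, Real.rpow_one]
    have h2 : η ^ (1 - ε) * η ^ (1 + ε) = η ^ 2 := by
      rw [← Real.rpow_add hη, show (1 : ℝ) - ε + (1 + ε) = 2 by ring, Real.rpow_two]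
    rw [hT, Real.mul_rpow hm0.le hη.le]
    calc (m : ℝ) ^ (1 - ε) * η ^ (1 - ε) * ((m : ℝ) ^ ε * η ^ (1 + ε))
        = ((m : ℝ) ^ (1 - ε) * (m : ℝ) ^ ε) * (η ^ (1 - ε) * η ^ (1 + ε)) := by ring
      _ = (m : ℝ) * η ^ 2 := by rw [h1, h2]
  have eT3 : T ^ ε * η = (m : ℝ) ^ ε * η ^ (1 + ε) := by
    rw [hT, Real.mul_rpow hm0.le hη.le, Real.rpow_add hη, Real.rpow_one]
    ring
  -- (E1) some draw exceeds `T`: union bound + Markov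
  have hE1 : P.real (⋃ j : Fin m, {ω | T < g (x j ω)}) ≤ A / ((m : ℝ) ^ ε * η ^ (1 + ε)) := by
    calc P.real (⋃ j : Fin m, {ω | T < g (x j ω)})
        ≤ ∑ j : Fin m, P.real {ω | T < g (x j ω)} := measureReal_iUnion_fintype_le _
      _ = ∑ j : Fin m, ν.real {a | T < g a} := by
          refine Finset.sum_congr rfl fun j _ => ?_
          rw [← hlaw j, map_measureReal_apply (hxm j) (measurableSet_lt measurable_const hgm)]
          rfl
      _ ≤ ∑ j : Fin m, A / T ^ (1 + ε) :=
          Finset.sum_le_sum fun j _ => measureReal_lt_le_rpow_moment hg0 hε0.le hA hT0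
      _ = (m : ℝ) * (A / T ^ (1 + ε)) := by
          rw [sum_const, card_univ, Fintype.card_fin, nsmul_eq_mul]
      _ = A / ((m : ℝ) ^ ε * η ^ (1 + ε)) := by
          rw [eT1]
          field_simp
  -- (E2) the truncated block mean deviates by `η/2` from its own mean: Chebyshev
  have hE2 : P.real {ω | η / 2 ≤ |(∑ j : Fin m, min (g (x j ω)) T) / m - ∫ a, min (g a) T ∂ν|}
      ≤ 4 * A / ((m : ℝ) ^ ε * η ^ (1 + ε)) := by
    have h := blockMean_chebyshev_iid hxm hind hlaw (g := fun a => min (g a) T)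
      (hgm.min measurable_const) (memLp_min_const hgm hg0 hT0.le) hm (u := η / 2) (by positivity)
    refine h.trans ?_
    have hV := variance_min_le hgm hg0 hε0.le hε1 hA hT0
    rw [div_le_div_iff₀ (by positivity) hD]
    calc Var[fun a => min (g a) T; ν] * ((m : ℝ) ^ ε * η ^ (1 + ε))
        ≤ T ^ (1 - ε) * A * ((m : ℝ) ^ ε * η ^ (1 + ε)) := mul_le_mul_of_nonneg_right hV hD.le
      _ = A * (T ^ (1 - ε) * ((m : ℝ) ^ ε * η ^ (1 + ε))) := by ring
      _ = A * ((m : ℝ) * η ^ 2) := by rw [eT2]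
      _ = 4 * A * (m * (η / 2) ^ 2) := by ring
  -- the truncation bias is at most `η/2` in the non-trivial regime
  obtain ⟨hminle, hbias⟩ := integral_sub_integral_min_le hgm hg0 hε0.le hA hT0
  have hbias' : ∫ a, g a ∂ν - ∫ a, min (g a) T ∂ν ≤ η / 2 := by
    have hTε : 0 < T ^ ε := Real.rpow_pos_of_pos hT0 _
    have h : A / T ^ ε ≤ η / 2 := by
      rw [div_le_iff₀ hTε]
      nlinarith [eT3]
    exact hbias.trans h
  -- inclusion of the bad event in (E1) ∪ (E2)
  have hsub : {ω | η ≤ |(∑ j : Fin m, g (x j ω)) / m - ∫ a, g a ∂ν|}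
      ⊆ (⋃ j : Fin m, {ω | T < g (x j ω)})
        ∪ {ω | η / 2 ≤ |(∑ j : Fin m, min (g (x j ω)) T) / m - ∫ a, min (g a) T ∂ν|} := by
    intro ω hω
    simp only [Set.mem_setOf_eq, Set.mem_union, Set.mem_iUnion] at hω ⊢
    by_contra hcon
    simp only [not_or, not_exists, not_lt, not_le] at hcon
    obtain ⟨hall, hdev⟩ := hcon
    have hmean : (∑ j : Fin m, min (g (x j ω)) T) / m = (∑ j : Fin m, g (x j ω)) / m := by
      congr 1
      exact Finset.sum_congr rfl fun j _ => min_eq_left (hall j)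
    rw [hmean] at hdev
    obtain ⟨hd1, hd2⟩ := abs_lt.1 hdev
    have hlt : |(∑ j : Fin m, g (x j ω)) / m - ∫ a, g a ∂ν| < η :=
      abs_lt.2 ⟨by linarith, by linarith⟩
    linarith
  calc P.real {ω | η ≤ |(∑ j : Fin m, g (x j ω)) / m - ∫ a, g a ∂ν|}
      ≤ P.real ((⋃ j : Fin m, {ω | T < g (x j ω)})
          ∪ {ω | η / 2 ≤ |(∑ j : Fin m, min (g (x j ω)) T) / m - ∫ a, min (g a) T ∂ν|}) :=
        measureReal_mono hsub
    _ ≤ A / ((m : ℝ) ^ ε * η ^ (1 + ε)) + 4 * A / ((m : ℝ) ^ ε * η ^ (1 + ε)) :=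
        (measureReal_union_le _ _).trans (add_le_add hE1 hE2)
    _ = 5 * A / ((m : ℝ) ^ ε * η ^ (1 + ε)) := by ring

/-! ## §4 The median of blocks under a `(1 + ε)`-th moment -/

/-- **MEDIAN OF BLOCK MEANS UNDER A `(1 + ε)`-TH MOMENT.**  `n` independent draws `y_j` with common
law `ν`; `g ≥ 0` measurable, `A = ∫ g^{1+ε} dν < ∞`, `0 < ε ≤ 1`; `m ≥ 1`, `R·m ≤ n`, `η > 0` with
`20A ≤ m^ε η^{1+ε}`; `Ḡ_r = Σ_{j<m} g(y_{rm+j})/m`: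
`P( #{r < R : η ≤ |Ḡ_r − ∫ g dν|} ≥ R/2 ) ≤ exp(−R/8)`. [ours] -/
theorem blockMean_medianOfBlocks_confidence_heavyTail {y : Fin n → Ω → X}
    (hym : ∀ j, Measurable (y j)) (hind : iIndepFun y P) (hlaw : ∀ j, Measure.map (y j) P = ν)
    (hgm : Measurable g) (hg0 : ∀ a, 0 ≤ g a) (hε0 : 0 < ε) (hε1 : ε ≤ 1)
    (hA : Integrable (fun a => g a ^ (1 + ε)) ν) (hm : 1 ≤ m) (hRm : R * m ≤ n) {η : ℝ}
    (hη : 0 < η) (hvt : 20 * ∫ a, g a ^ (1 + ε) ∂ν ≤ (m : ℝ) ^ ε * η ^ (1 + ε)) :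
    P.real {ω | (R : ℝ) / 2 ≤ #{r ∈ (univ : Finset (Fin R)) | η ≤
        |(∑ j : Fin m, g (y ⟨((r : Fin R) : ℕ) * m + j, mul_add_lt hRm r j⟩ ω)) / m
          - ∫ a, g a ∂ν|}} ≤ exp (-(R / 8)) := by
  have hm0 : (0 : ℝ) < m := by exact_mod_cast hm
  have hD : 0 < (m : ℝ) ^ ε * η ^ (1 + ε) :=
    mul_pos (Real.rpow_pos_of_pos hm0 _) (Real.rpow_pos_of_pos hη _)
  have hg' : Measurable fun (v : Fin m → X) => (∑ j : Fin m, g (v j)) / (m : ℝ) :=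
    (Finset.measurable_sum _ fun (j : Fin m) _ => hgm.comp (measurable_pi_apply j)).div_const _
  have hYind : iIndepFun (fun (r : Fin R) ω =>
      (∑ j : Fin m, g (y ⟨(r : ℕ) * m + j, mul_add_lt hRm r j⟩ ω)) / (m : ℝ)) P :=
    iIndepFun_blockFun hym hind hRm hg'
  have hYm : ∀ r : Fin R, Measurable fun ω =>
      (∑ j : Fin m, g (y ⟨(r : ℕ) * m + j, mul_add_lt hRm r j⟩ ω)) / (m : ℝ) := fun r => by
    have hblk : Measurable fun ω => fun (i : Fin m) => y ⟨(r : ℕ) * m + i, mul_add_lt hRm r i⟩ ω :=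
      measurable_pi_lambda _ fun i => hym _
    exact hg'.comp hblk
  have hfar : ∀ r ∈ (univ : Finset (Fin R)), P.real {ω | η ≤
      |(∑ j : Fin m, g (y ⟨(r : ℕ) * m + j, mul_add_lt hRm r j⟩ ω)) / m - ∫ a, g a ∂ν|}
        ≤ 1 / 4 := by
    intro r _
    refine (blockMean_heavyTail_iid
      (x := fun (i : Fin m) => y ⟨(r : ℕ) * m + i, mul_add_lt hRm r i⟩) (fun i => hym _)
      (iIndepFun_block hind hRm r) (fun i => hlaw _) hgm hg0 hε0 hε1 hA hm hη).trans ?_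
    rw [div_le_iff₀ hD]
    linarith
  have h := measureReal_half_far_le (μ := P) (univ : Finset (Fin R)) hYind hYm (∫ a, g a ∂ν) η
    hfar
  simpa only [card_univ, Fintype.card_fin] using h

/-- **The same for ANY sample-median selection** `med(ω)` of the `R` block means (at least half
`≥ med ω`, at least half `≤ med ω`): `20A ≤ m^ε η^{1+ε}` ⇒ `P(η ≤ |med − ∫ g dν|) ≤ exp(−R/8)`.
[ours] -/
theorem blockMean_sampleMedian_confidence_heavyTail {y : Fin n → Ω → X}
    (hym : ∀ j, Measurable (y j)) (hind : iIndepFun y P) (hlaw : ∀ j, Measure.map (y j) P = ν)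
    (hgm : Measurable g) (hg0 : ∀ a, 0 ≤ g a) (hε0 : 0 < ε) (hε1 : ε ≤ 1)
    (hA : Integrable (fun a => g a ^ (1 + ε)) ν) (hm : 1 ≤ m) (hRm : R * m ≤ n) {η : ℝ}
    (hη : 0 < η) (hvt : 20 * ∫ a, g a ^ (1 + ε) ∂ν ≤ (m : ℝ) ^ ε * η ^ (1 + ε)) {med : Ω → ℝ}
    (hlo : ∀ ω, (R : ℝ) / 2 ≤ #{r ∈ (univ : Finset (Fin R)) | med ω ≤
        (∑ j : Fin m, g (y ⟨((r : Fin R) : ℕ) * m + j, mul_add_lt hRm r j⟩ ω)) / m})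
    (hhi : ∀ ω, (R : ℝ) / 2 ≤ #{r ∈ (univ : Finset (Fin R)) |
        (∑ j : Fin m, g (y ⟨((r : Fin R) : ℕ) * m + j, mul_add_lt hRm r j⟩ ω)) / m ≤ med ω}) :
    P.real {ω | η ≤ |med ω - ∫ a, g a ∂ν|} ≤ exp (-(R / 8)) := by
  refine (measureReal_mono ?_).trans
    (blockMean_medianOfBlocks_confidence_heavyTail hym hind hlaw hgm hg0 hε0 hε1 hA hm hRm hη hvt)
  intro ω hω
  simp only [Set.mem_setOf_eq] at hω ⊢
  by_contra hlt
  push Not at hlt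
  have hR : (#(univ : Finset (Fin R)) : ℝ) = R := by rw [card_univ, Fintype.card_fin]
  have h := abs_median_sub_lt_of_card_lt (univ : Finset (Fin R)) _ (hR ▸ hlo ω) (hR ▸ hhi ω)
    (hR ▸ hlt)
  linarith

end BlockMean

end Summit.Ventures.LatticeQCDFlow.Scoring.HeavyTailMedian

end
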